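import Literature.NumberTheory.Transcendental.RoySmallValueEstimatesResultantProofs
import HarnessLib

/-!
# Small value estimates at rational translates (Nguyen–Roy 2016) — proofs, XII: the degree of `Res_D`, lower bound

Twelfth proofs file towards `Literature.NumberTheory.Transcendental.nguyenRoy2016_thm_1` (Nguyen–Roy,
IJNT 12 (2016) = arXiv:1412.5163), continuing file XI (`RoySmallValueEstimatesResultantProofs.lean`:
the resultant `NguyenRoy.resD m D` of `m + 1` forms of degree `D` in `m + 1` variables, as the
Chow form of the Veronese ideal `𝔙_D`). Roy's proof of the multiplicity estimate (Mathematika 59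
(2013) = arXiv:1301.0663, Theorem 5.2) uses that `Res_D` "is homogeneous of degree `D^m` on each
factor of `ℂ[X]_D^{m+1}`". File XI gives equal block degrees `deg 𝔙_D`; here we PROVE

* `NguyenRoy.pow_le_ideg_veroIdeal` — **the lower bound `D^m ≤ deg 𝔙_D`** (`m ≥ 1`, `D ≥ 2`),

by an explicit pencil: specialise the first `m` forms to `∏_{j<D} (x_i − j x_m)` (`splitForm`) and
the last one to `A − tB`, `A = (∑_{i<m} D^i x_i) x_m^{D−1}`, `B = x_m^D` (`pencilSpec`). The
specialisation `f(t) ∈ ℚ[t]` of `Res_D` (`pencilPoly`) has degree `≤ deg_{u_m} Res_D = deg 𝔙_D`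
(`natDegree_aeval_le_blockDeg`, a general one-block pencil bound), vanishes at `t = n` for every
`n < D^m` (write `n = ∑ D^i j_i` in base `D`, `exists_digits`; the point `(j₀:…:j_{m−1}:1)` is a
common zero, by the zeros theorem `aeval_resD_eq_zero_iff` of file XI), and `f(−1) ≠ 0` (no common
zero), whence `D^m ≤ #roots ≤ deg f ≤ deg 𝔙_D`.

Also proved here, for the sequel (the determinant `Φ` of R2013 Theorem 5.2, which gives the upper
bound): **`x₀^D, …, x_m^D` is a regular sequence** in the sense of file X (`purePow_regular`, via the
monomial-ideal membership criterion `MvPolynomial.mem_ideal_span_monomial_image`).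

Definitions are the explicit forms/specialisations of the proof; no named facts.

## References

* [Roy2013] D. Roy, *A small value estimate for 𝔾ₐ × 𝔾ₘ*, Mathematika 59 (2013) = arXiv:1301.0663,
  §5, proof of Theorem 5.2 ("the resultant is homogeneous of degree `D^m` on each factor").
* [NesterenkoPhilippon2001] Yu. V. Nesterenko, P. Philippon (eds.), LNM 1752 (2001), Ch. 3 §4,
  Def. 4.5 (`deg I = deg_{u₁} F`), Prop. 4.4 (p. 38).
* [NguyenRoy2016] N. A. V. Nguyen, D. Roy, IJNT 12 (2016) = arXiv:1412.5163, §4.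
-/

noncomputable section

open MvPolynomial Finset

attribute [local instance] MvPolynomial.gradedAlgebra

namespace Literature.NumberTheory.Transcendental

namespace NguyenRoy

attribute [local instance] fintypeMonoIdx

/-! ## Pure powers `x₀^D, …, x_m^D` form a regular sequence -/

section PurePowers

variable {K : Type*} [Field K]

/-- The sequence `x₀^D, x₁^D, …, x_m^D` (and `0` beyond), as a sequence indexed by `ℕ`. [folklore] -/
def purePow (m D i : ℕ) : MvPolynomial (Fin (m + 1)) K :=
  if h : i < m + 1 then X ⟨i, h⟩ ^ D else 0

/-- `purePow m D i = x_i^D` for `i ≤ m`. [folklore] -/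
theorem purePow_of_lt (m D : ℕ) {i : ℕ} (h : i < m + 1) :
    (purePow m D i : MvPolynomial (Fin (m + 1)) K) = X ⟨i, h⟩ ^ D := dif_pos h

/-- Each `x_i^D` is a form of degree `D`. [folklore] -/
theorem isHomogeneous_purePow (m D i : ℕ) :
    (purePow m D i : MvPolynomial (Fin (m + 1)) K).IsHomogeneous D := by
  unfold purePow
  split_ifs
  · exact isHomogeneous_X_pow _ _
  · exact isHomogeneous_zero _ _ _

/-- `(x₀^D, …, x_{j−1}^D)` is the monomial ideal generated by the `x^{De_i}`, `i < j`. [folklore] -/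
theorem span_purePow_eq (m D j : ℕ) (hj : j ≤ m + 1) :
    Ideal.span (Set.range fun i : Fin j => (purePow m D i : MvPolynomial (Fin (m + 1)) K)) =
      Ideal.span ((fun s => monomial s (1 : K)) ''
        {s | ∃ i : Fin (m + 1), (i : ℕ) < j ∧ s = Finsupp.single i D}) := by
  congr 1
  ext P
  constructor
  · rintro ⟨i, rfl⟩
    refine ⟨Finsupp.single ⟨i, by omega⟩ D, ⟨⟨i, by omega⟩, i.isLt, rfl⟩, ?_⟩
    simp only
    rw [purePow_of_lt m D (by omega), X_pow_eq_monomial]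
  · rintro ⟨s, ⟨i, hi, rfl⟩, rfl⟩
    refine ⟨⟨i, hi⟩, ?_⟩
    simp only
    rw [purePow_of_lt m D i.isLt, X_pow_eq_monomial]

/-- **`x₀^D, …, x_m^D` is a regular sequence**: if `x_j^D F ∈ (x₀^D, …, x_{j−1}^D)` then
`F ∈ (x₀^D, …, x_{j−1}^D)` (a monomial ideal: compare supports). [folklore] -/
theorem purePow_regular (m D j : ℕ) (hj : j ≤ m) (F : MvPolynomial (Fin (m + 1)) K)
    (hF : purePow m D j * F ∈
      Ideal.span (Set.range fun i : Fin j => (purePow m D i : MvPolynomial (Fin (m + 1)) K))) :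
    F ∈ Ideal.span (Set.range fun i : Fin j => (purePow m D i : MvPolynomial (Fin (m + 1)) K)) := by
  have hj' : j < m + 1 := by omega
  rw [span_purePow_eq m D j (by omega), mem_ideal_span_monomial_image] at hF ⊢
  intro xi hxi
  have hmem : Finsupp.single (⟨j, hj'⟩ : Fin (m + 1)) D + xi ∈ (purePow m D j * F).support := by
    rw [mem_support_iff, purePow_of_lt m D hj', X_pow_eq_monomial, coeff_monomial_mul, one_mul]
    exact mem_support_iff.mp hxi
  obtain ⟨si, ⟨i, hi, rfl⟩, hle⟩ := hF _ hmem
  refine ⟨Finsupp.single i D, ⟨i, hi, rfl⟩, ?_⟩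
  intro k
  have h := hle k
  rw [Finsupp.add_apply, Finsupp.single_apply, Finsupp.single_apply] at h
  rw [Finsupp.single_apply]
  by_cases hik : i = k
  · subst hik
    rw [if_pos rfl] at h ⊢
    have hne : (⟨j, hj'⟩ : Fin (m + 1)) ≠ i := by
      intro h'
      have := congrArg Fin.val h'
      simp only at this
      omega
    rw [if_neg hne, zero_add] at h
    exact h
  · rw [if_neg hik]
    exact Nat.zero_le _

end PurePowers

/-! ## The degree of `Res_D`: the lower bound `D^m ≤ deg 𝔙_D` -/

section DegreeLowerBound

/-- Monomials in the support contribute at most `blockDeg` in each block. [folklore] -/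
theorem sum_le_blockDeg' {r N : ℕ} {G : Nesterenko.RU r N} {e : Fin r × Fin (N + 1) →₀ ℕ}
    (he : e ∈ G.support) (i : Fin r) : ∑ j, e (i, j) ≤ Nesterenko.blockDeg G i :=
  Finset.le_sup (f := fun e : Fin r × Fin (N + 1) →₀ ℕ => ∑ j : Fin (N + 1), e (i, j)) he

/-- **Degree of a one-block pencil specialisation**: if the variables of block `i` are sent to
polynomials of degree `≤ 1` in `t` and all other variables to constants, the specialisation of `G`
has degree `≤ deg_{uᵢ} G` in `t`. [folklore] -/
theorem natDegree_aeval_le_blockDeg {r N : ℕ} (G : Nesterenko.RU r N) (i : Fin r)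
    (g : Fin r × Fin (N + 1) → Polynomial ℚ) (hg1 : ∀ j, (g (i, j)).natDegree ≤ 1)
    (hg0 : ∀ v, v.1 ≠ i → (g v).natDegree = 0) :
    (aeval g G).natDegree ≤ Nesterenko.blockDeg G i := by
  classical
  rw [MvPolynomial.aeval_def, MvPolynomial.eval₂_eq]
  refine Polynomial.natDegree_sum_le_of_forall_le _ _ fun e he => ?_
  refine Polynomial.natDegree_mul_le.trans ?_
  rw [show ((algebraMap ℚ (Polynomial ℚ)) (coeff e G)).natDegree = 0 from Polynomial.natDegree_C _,
    zero_add]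
  refine (Polynomial.natDegree_prod_le _ _).trans ?_
  calc ∑ v ∈ e.support, (g v ^ e v).natDegree
      ≤ ∑ v ∈ e.support, (if v.1 = i then e v else 0) := by
        refine Finset.sum_le_sum fun v _ => ?_
        refine Polynomial.natDegree_pow_le.trans ?_
        split_ifs with hv
        · calc e v * (g v).natDegree ≤ e v * 1 := by
                refine Nat.mul_le_mul_left _ ?_
                obtain ⟨i', j⟩ := v
                simp only at hv
                subst hv
                exact hg1 j
            _ = e v := mul_one _
        · rw [hg0 v hv, mul_zero]
    _ = ∑ v ∈ e.support.filter (fun v => v.1 = i), e v := (Finset.sum_filter _ _).symm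
    _ ≤ ∑ v ∈ (Finset.univ : Finset (Fin (N + 1))).map
          ⟨fun j => (i, j), fun a b h => (Prod.mk.inj h).2⟩, e v := by
        refine Finset.sum_le_sum_of_subset_of_nonneg ?_ fun _ _ _ => Nat.zero_le _
        intro v hv
        rw [Finset.mem_filter] at hv
        rw [Finset.mem_map]
        refine ⟨v.2, Finset.mem_univ _, ?_⟩
        obtain ⟨a, b⟩ := v
        simp only at hv
        rw [← hv.2]
        rfl
    _ = ∑ j, e (i, j) := by rw [Finset.sum_map]; rfl
    _ ≤ Nesterenko.blockDeg G i := sum_le_blockDeg' he i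

/-- Evaluating a pencil specialisation at `t = τ`. [folklore] -/
theorem eval_aeval_eq {σ : Type*} (g : σ → Polynomial ℚ) (G : MvPolynomial σ ℚ) (τ : ℚ) :
    (aeval g G).eval τ = aeval (fun v => (g v).eval τ) G := by
  rw [← Polynomial.coe_aeval_eq_eval, ← AlgHom.comp_apply, MvPolynomial.comp_aeval]

variable (m D : ℕ)

/-- A form of degree `D` evaluated at `x` is `∑_j [x^{α_j}]P · x^{α_j}`. [folklore] -/
theorem aeval_eq_sum_coeff_mul_veroPt {P : Nesterenko.Rx m} (hP : P.IsHomogeneous D)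
    (x : Fin (m + 1) → ℂ) :
    aeval x P = ∑ j, ((coeff (vexp m D j) P : ℚ) : ℂ) * veroPt m D x j := by
  classical
  set f : (Fin (m + 1) →₀ ℕ) → ℂ := fun d => ((coeff d P : ℚ) : ℂ) * ∏ k, x k ^ d k with hf
  have h1 : aeval x P = ∑ d ∈ P.support, f d := by
    rw [MvPolynomial.aeval_def, MvPolynomial.eval₂_eq]
    refine Finset.sum_congr rfl fun d _ => ?_
    simp only [hf]
    rw [eq_ratCast]
    congr 1
    exact Finsupp.prod_fintype d (fun k e => x k ^ e) fun k => pow_zero (x k)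
  have h2 : ∑ j, ((coeff (vexp m D j) P : ℚ) : ℂ) * veroPt m D x j =
      ∑ d ∈ (Finset.univ : Finset (Fin (veroN m D + 1))).image (vexp m D), f d := by
    rw [Finset.sum_image fun a _ b _ h => vexp_injective m D h]
    simp only [hf]
    rfl
  rw [h1, h2]
  refine Finset.sum_subset ?_ ?_
  · intro d hd
    rw [Finset.mem_image]
    exact ⟨vidx m D d (degree_eq_of_mem_support hP hd), Finset.mem_univ _, vexp_vidx m D _ _⟩
  · intro d _ hd
    simp only [hf]
    rw [notMem_support_iff.mp hd, Rat.cast_zero, zero_mul]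

/-! ### The special forms `∏_{j<D}(x_i − j x_m)`, `(∑ D^i x_i) x_m^{D−1}`, `x_m^D` -/

/-- `∏_{j<D} (x_i − j x_m)`: a form of degree `D` splitting into rational linear factors. [folklore] -/
def splitForm (i : Fin (m + 1)) : Nesterenko.Rx m :=
  ∏ j ∈ Finset.range D, (X i - C (j : ℚ) * X (Fin.last m))

/-- `splitForm` is a form of degree `D`. [folklore] -/
theorem isHomogeneous_splitForm (i : Fin (m + 1)) : (splitForm m D i).IsHomogeneous D := by
  have h : (splitForm m D i).IsHomogeneous (∑ _j ∈ Finset.range D, 1) := by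
    refine IsHomogeneous.prod _ _ _ fun j _ => ?_
    refine (isHomogeneous_X ℚ i).sub ?_
    simpa using (isHomogeneous_C (Fin (m + 1)) (j : ℚ)).mul (isHomogeneous_X ℚ (Fin.last m))
  simpa using h

/-- `splitForm i (x) = ∏_{j<D} (x_i − j x_m)`. [folklore] -/
theorem aeval_splitForm (i : Fin (m + 1)) (x : Fin (m + 1) → ℂ) :
    aeval x (splitForm m D i) = ∏ j ∈ Finset.range D, (x i - (j : ℂ) * x (Fin.last m)) := by
  simp [splitForm, map_prod]

/-- `A = (∑_{i<m} D^i x_i) · x_m^{D−1}`. [folklore] -/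
def pencilA : Nesterenko.Rx m :=
  (∑ i : Fin m, C ((D : ℚ) ^ (i : ℕ)) * X (Fin.castSucc i)) * X (Fin.last m) ^ (D - 1)

/-- `B = x_m^D`. [folklore] -/
def pencilB : Nesterenko.Rx m := X (Fin.last m) ^ D

variable {m D} in
/-- `A` is a form of degree `D` (`D ≥ 1`). [folklore] -/
theorem isHomogeneous_pencilA (hD : 1 ≤ D) : (pencilA m D).IsHomogeneous D := by
  have h1 : (∑ i : Fin m, C ((D : ℚ) ^ (i : ℕ)) * X (Fin.castSucc i) : Nesterenko.Rx m).IsHomogeneous 1 := by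
    refine IsHomogeneous.sum _ _ _ fun i _ => ?_
    simpa using (isHomogeneous_C (Fin (m + 1)) ((D : ℚ) ^ (i : ℕ))).mul
      (isHomogeneous_X ℚ (Fin.castSucc i))
  have h := h1.mul (isHomogeneous_X_pow (R := ℚ) (Fin.last m) (D - 1))
  rwa [show 1 + (D - 1) = D by omega] at h

/-- `B` is a form of degree `D`. [folklore] -/
theorem isHomogeneous_pencilB : (pencilB m D).IsHomogeneous D := isHomogeneous_X_pow _ _

/-- `A(x) = (∑ D^i x_i) x_m^{D−1}`. [folklore] -/
theorem aeval_pencilA (x : Fin (m + 1) → ℂ) :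
    aeval x (pencilA m D) =
      (∑ i : Fin m, (D : ℂ) ^ (i : ℕ) * x (Fin.castSucc i)) * x (Fin.last m) ^ (D - 1) := by
  simp [pencilA, map_sum]

/-- `B(x) = x_m^D`. [folklore] -/
theorem aeval_pencilB (x : Fin (m + 1) → ℂ) : aeval x (pencilB m D) = x (Fin.last m) ^ D := by
  simp [pencilB]

/-- The forms of the specialisation at `t = τ`: `Q_i = splitForm i` for `i < m` and
`Q_m = A − τ B`. [folklore] -/
def pencilForm (τ : ℚ) (i : Fin (m + 1)) : Nesterenko.Rx m :=
  if i = Fin.last m then pencilA m D - C τ * pencilB m D else splitForm m D i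

variable {m D} in
/-- Each `Q_i` is a form of degree `D`. [folklore] -/
theorem isHomogeneous_pencilForm (hD : 1 ≤ D) (τ : ℚ) (i : Fin (m + 1)) :
    (pencilForm m D τ i).IsHomogeneous D := by
  unfold pencilForm
  split_ifs
  · refine (isHomogeneous_pencilA hD).sub ?_
    simpa using (isHomogeneous_C (Fin (m + 1)) τ).mul (isHomogeneous_pencilB m D)
  · exact isHomogeneous_splitForm m D i

/-- **The pencil specialisation** of the generic coefficients: `u_{i,j} ↦ [x^{α_j}] splitForm i`
for `i < m`, `u_{m,j} ↦ [x^{α_j}]A − [x^{α_j}]B · t`. [folklore] -/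
def pencilSpec (v : Fin (m + 1) × Fin (veroN m D + 1)) : Polynomial ℚ :=
  if v.1 = Fin.last m then
    Polynomial.C (coeff (vexp m D v.2) (pencilA m D)) -
      Polynomial.C (coeff (vexp m D v.2) (pencilB m D)) * Polynomial.X
  else Polynomial.C (coeff (vexp m D v.2) (splitForm m D v.1))

/-- `f(t) = Res_D(splitForm₀, …, splitForm_{m−1}, A − tB) ∈ ℚ[t]`. [folklore] -/
def pencilPoly : Polynomial ℚ := aeval (pencilSpec m D) (resD m D)

variable {m D} in
/-- **`deg f ≤ deg_{u_m} Res_D = deg 𝔙_D`.** [folklore] -/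
theorem natDegree_pencilPoly_le (hm : 1 ≤ m) (hD : 2 ≤ D) :
    (pencilPoly m D).natDegree ≤ Nesterenko.ideg (veroIdeal m D) (m + 1) := by
  rw [← blockDeg_resD hm hD (Fin.last m), pencilPoly]
  refine natDegree_aeval_le_blockDeg _ _ _ (fun j => ?_) (fun v hv => ?_)
  · rw [pencilSpec, if_pos rfl]
    refine (Polynomial.natDegree_sub_le _ _).trans ?_
    rw [Polynomial.natDegree_C, Nat.zero_max]
    refine Polynomial.natDegree_mul_le.trans ?_
    rw [Polynomial.natDegree_C, zero_add]
    exact Polynomial.natDegree_X_le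
  · rw [pencilSpec, if_neg hv, Polynomial.natDegree_C]

/-- The specialisation at `t = τ` is the coefficient vector of the forms `Q_i`. [folklore] -/
theorem eval_pencilSpec (τ : ℚ) (v : Fin (m + 1) × Fin (veroN m D + 1)) :
    (pencilSpec m D v).eval τ = coeff (vexp m D v.2) (pencilForm m D τ v.1) := by
  unfold pencilSpec pencilForm
  split_ifs with h
  · simp only [Polynomial.eval_sub, Polynomial.eval_C, Polynomial.eval_mul, Polynomial.eval_X,
      coeff_sub, coeff_C_mul]
    ring
  · rw [Polynomial.eval_C]

variable {m D} in
/-- **`f(τ) = 0` iff the forms `splitForm₀, …, splitForm_{m−1}, A − τB` have a common zero in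
`ℙ^m(ℂ)`** (the zeros theorem for `Res_D`). [folklore] -/
theorem eval_pencilPoly_eq_zero_iff (hm : 1 ≤ m) (hD : 2 ≤ D) (τ : ℚ) :
    (pencilPoly m D).eval τ = 0 ↔
      ∃ x : Fin (m + 1) → ℂ, x ≠ 0 ∧ ∀ i, aeval x (pencilForm m D τ i) = 0 := by
  have hcast : (((pencilPoly m D).eval τ : ℚ) : ℂ) =
      aeval (fun v => ((coeff (vexp m D v.2) (pencilForm m D τ v.1) : ℚ) : ℂ)) (resD m D) := by
    rw [pencilPoly, eval_aeval_eq]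
    simp_rw [eval_pencilSpec]
    rw [show (fun v : Fin (m + 1) × Fin (veroN m D + 1) =>
        ((coeff (vexp m D v.2) (pencilForm m D τ v.1) : ℚ) : ℂ)) =
        algebraMap ℚ ℂ ∘ fun v => coeff (vexp m D v.2) (pencilForm m D τ v.1) from rfl,
      MvPolynomial.aeval_algebraMap_apply]
    rfl
  rw [← Rat.cast_eq_zero (α := ℂ), hcast, aeval_resD_eq_zero_iff hm hD]
  refine exists_congr fun x => and_congr_right fun _ => forall_congr' fun i => ?_
  dsimp only
  rw [aeval_eq_sum_coeff_mul_veroPt m D (isHomogeneous_pencilForm (by omega) τ i) x]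

/-! ### The roots of `f` -/

variable {m D} in
/-- **`f(n) = 0` for every `n = ∑ D^i j_i` with digits `j_i < D`**: the point
`(j₀, …, j_{m−1}, 1)` is a common zero. [folklore] -/
theorem eval_pencilPoly_digits (hm : 1 ≤ m) (hD : 2 ≤ D) (j : Fin m → ℕ) (hj : ∀ i, j i < D) :
    (pencilPoly m D).eval (∑ i : Fin m, (D : ℚ) ^ (i : ℕ) * j i) = 0 := by
  rw [eval_pencilPoly_eq_zero_iff hm hD]
  refine ⟨Fin.snoc (fun i => (j i : ℂ)) 1, ?_, fun i => ?_⟩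
  · intro h
    have := congrFun h (Fin.last m)
    rw [Fin.snoc_last, Pi.zero_apply] at this
    exact one_ne_zero this
  · unfold pencilForm
    split_ifs with hi
    · rw [map_sub, map_mul, aeval_C, aeval_pencilA, aeval_pencilB]
      simp only [Fin.snoc_last, Fin.snoc_castSucc, one_pow, mul_one, eq_ratCast]
      push_cast
      ring
    · obtain ⟨i', rfl⟩ := Fin.exists_castSucc_eq.mpr hi
      rw [aeval_splitForm]
      refine Finset.prod_eq_zero (Finset.mem_range.mpr (hj i')) ?_
      simp

variable {m D} in
/-- **`f(−1) ≠ 0`**: the forms `splitForm_i` and `A + B` have no common zero (a common zero has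
`x_m ≠ 0`, `x_i = j_i x_m` with `j_i < D`, and then `(A + B)(x) = x_m^D (∑ D^i j_i + 1) ≠ 0`).
[folklore] -/
theorem eval_pencilPoly_neg_one_ne_zero (hm : 1 ≤ m) (hD : 2 ≤ D) :
    (pencilPoly m D).eval (-1) ≠ 0 := by
  rw [Ne, eval_pencilPoly_eq_zero_iff hm hD]
  rintro ⟨x, hx0, hx⟩
  -- digits
  have hdig : ∀ i : Fin m, ∃ j : ℕ, j < D ∧ x (Fin.castSucc i) = (j : ℂ) * x (Fin.last m) := by
    intro i
    have h := hx (Fin.castSucc i)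
    rw [pencilForm, if_neg (Fin.castSucc_lt_last i).ne, aeval_splitForm,
      Finset.prod_eq_zero_iff] at h
    obtain ⟨j, hj, h⟩ := h
    exact ⟨j, Finset.mem_range.mp hj, sub_eq_zero.mp h⟩
  choose j hj hxj using hdig
  -- `x_m ≠ 0`
  have hxm : x (Fin.last m) ≠ 0 := by
    intro h0
    apply hx0
    funext k
    induction k using Fin.lastCases with
    | last => exact h0
    | cast i => rw [hxj i, h0, mul_zero]; rfl
  -- the pencil form at `τ = −1`
  have h := hx (Fin.last m)
  rw [pencilForm, if_pos rfl, map_sub, map_mul, aeval_C, aeval_pencilA, aeval_pencilB] at h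
  simp_rw [hxj] at h
  have hS : ∑ i : Fin m, (D : ℂ) ^ (i : ℕ) * ((j i : ℂ) * x (Fin.last m)) =
      (∑ i : Fin m, (D : ℂ) ^ (i : ℕ) * (j i : ℂ)) * x (Fin.last m) := by
    rw [Finset.sum_mul]
    exact Finset.sum_congr rfl fun i _ => by ring
  have e : x (Fin.last m) ^ D = x (Fin.last m) * x (Fin.last m) ^ (D - 1) := by
    rw [← pow_succ', Nat.sub_add_cancel (by omega)]
  rw [hS, map_neg, map_one, e] at h
  have key : (∑ i : Fin m, (D : ℂ) ^ (i : ℕ) * (j i : ℂ)) * x (Fin.last m) *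
        x (Fin.last m) ^ (D - 1) - (-1) * (x (Fin.last m) * x (Fin.last m) ^ (D - 1)) =
      ((∑ i : Fin m, D ^ (i : ℕ) * j i + 1 : ℕ) : ℂ) * (x (Fin.last m) * x (Fin.last m) ^ (D - 1)) := by
    push_cast
    ring
  rw [key, mul_eq_zero, ← e] at h
  rcases h with h | h
  · exact absurd h (Nat.cast_ne_zero.mpr (by omega))
  · exact hxm (pow_eq_zero_iff (by omega) |>.mp h)

/-- Base-`D` digits: every `n < D^m` is `∑_{i<m} D^i j_i` with `j_i < D` (`D ≥ 1`). [folklore] -/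
theorem exists_digits {D : ℕ} (hD : 1 ≤ D) :
    ∀ (m n : ℕ), n < D ^ m → ∃ j : Fin m → ℕ, (∀ i, j i < D) ∧ ∑ i : Fin m, D ^ (i : ℕ) * j i = n := by
  intro m
  induction m with
  | zero =>
    intro n hn
    refine ⟨fun i => i.elim0, fun i => i.elim0, ?_⟩
    simp only [Finset.univ_eq_empty, Finset.sum_empty]
    simp at hn
    omega
  | succ m ih =>
    intro n hn
    have hD0 : 0 < D := hD
    obtain ⟨j', hj', hsum⟩ := ih (n / D) (by
      rw [Nat.div_lt_iff_lt_mul hD0]; rwa [pow_succ] at hn)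
    refine ⟨Fin.cons (n % D) j', fun i => ?_, ?_⟩
    · induction i using Fin.cases with
      | zero => simpa using Nat.mod_lt n hD0
      | succ i => simpa using hj' i
    · rw [Fin.sum_univ_succ]
      simp only [Fin.cons_zero, Fin.cons_succ, Fin.val_zero, pow_zero, one_mul, Fin.val_succ,
        pow_succ]
      have : ∑ i : Fin m, D ^ (i : ℕ) * D * j' i = D * ∑ i : Fin m, D ^ (i : ℕ) * j' i := by
        rw [Finset.mul_sum]
        refine Finset.sum_congr rfl fun i _ => by ring
      rw [this, hsum]
      exact Nat.mod_add_div n D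

variable {m D} in
/-- **The lower bound `D^m ≤ deg 𝔙_D`** (`m ≥ 1`, `D ≥ 2`): the pencil polynomial `f` is non-zero
(`f(−1) ≠ 0`), has degree `≤ deg 𝔙_D`, and vanishes at the `D^m` integers `0, 1, …, D^m − 1`.
[folklore] -/
theorem pow_le_ideg_veroIdeal (hm : 1 ≤ m) (hD : 2 ≤ D) :
    D ^ m ≤ Nesterenko.ideg (veroIdeal m D) (m + 1) := by
  classical
  set f := pencilPoly m D with hf
  have hf0 : f ≠ 0 := fun h => eval_pencilPoly_neg_one_ne_zero hm hD (by rw [← hf, h, Polynomial.eval_zero])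
  -- the `D^m` distinct roots
  have hroots : (Finset.range (D ^ m)).image (fun n : ℕ => (n : ℚ)) ⊆ f.roots.toFinset := by
    intro q hq
    obtain ⟨n, hn, rfl⟩ := Finset.mem_image.mp hq
    obtain ⟨j, hj, hsum⟩ := exists_digits (by omega : 1 ≤ D) m n (Finset.mem_range.mp hn)
    rw [Multiset.mem_toFinset, Polynomial.mem_roots hf0, Polynomial.IsRoot.def, ← hsum]
    push_cast
    exact eval_pencilPoly_digits hm hD j hj
  have hcard : ((Finset.range (D ^ m)).image (fun n : ℕ => (n : ℚ))).card = D ^ m := by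
    rw [Finset.card_image_of_injective _ Nat.cast_injective, Finset.card_range]
  calc D ^ m = ((Finset.range (D ^ m)).image (fun n : ℕ => (n : ℚ))).card := hcard.symm
    _ ≤ f.roots.toFinset.card := Finset.card_le_card hroots
    _ ≤ Multiset.card f.roots := Multiset.toFinset_card_le _
    _ ≤ f.natDegree := Polynomial.card_roots' f
    _ ≤ Nesterenko.ideg (veroIdeal m D) (m + 1) := natDegree_pencilPoly_le hm hD

end DegreeLowerBound

end NguyenRoy

end Literature.NumberTheory.Transcendental
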